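import Mathlib
import Literature.Computability.AlgebraicComplexity.BorderRankRestriction
import Literature.Computability.AlgebraicComplexity.GroupAlgebraTensor
import Summits.MatrixMultiplication.MatrixMultiplication.Theorems.OrbitHarmonicsHostsReesBoundGraded
import Summits.MatrixMultiplication.MatrixMultiplication.Theses.OrbitHarmonicsHosts

/-!
# `OrbitHarmonicsHosts.ReesBound` — the orbit-harmonics ring of a finite point set has minimal border rank

Route `MatrixMultiplication/OrbitHarmonicsHosts`, item `stmt-MatrixMultiplication-5458` (support), PROVED as stated
(`reesBound_proof`): for a finite point set `P ⊂ ℂ^d` the orbit-harmonics ring `A = ℂ[x]/⟨LF(I(P))⟩`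
(`LF` = top-degree form, `I(P)` = `MvPolynomial.vanishingIdeal`) has a basis indexed by `Fin |P|` whose structure
tensor has algebraic (`K[ε]`) border rank `≤ |P|`.

Proof: the graded tools of `OrbitHarmonicsHostsReesBoundGraded.lean` applied to `Φ : ℂ[x] →ₐ ℂ^P`, evaluation at
the points (`AlgHom.pi` of `MvPolynomial.aeval`), whose kernel is `I(P)` and which is onto by multivariate Lagrange
interpolation (`exists_mvPolynomial_indicator`). A monomial basis `h` of `A` (`exists_linearIndependent'` on the
spanning family of monomials) then has `Φ ∘ h` a basis of `ℂ^P` — so it is finite with `|P|` elements — and the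
structure tensor `c` of `ℂ^P` in that basis (a restriction of the diagonal tensor: `|P|` triads,
`exists_structureTensor_pi_eq_sum`) gives `h i h j - ∑ c h ∈ I(P)`; the Rees degeneration
(`algBorderRank_structureTensor_le_of_graded`) bounds `bR(structureTensor)` by `|P|`, and border rank is invariant
under reindexing the basis by `Fin |P|` (`algBorderRank_reindex`).
Sources: Bläser–Lysikov 2016 (smoothable algebras have minimal border rank), Garsia–Procesi 1992 (orbit harmonics),
Bläser 2013 Def. 6.1.
-/

-- `Summit.<Summit>.<Problem>` is the tree's mandated summit-side namespace; for this single-conjunct summit the two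
-- components coincide, so the file silences `dupNamespace`.
set_option linter.dupNamespace false
set_option autoImplicit false

noncomputable section

open scoped BigOperators Polynomial
open MvPolynomial Literature.Computability.AlgebraicComplexity

namespace Summit.MatrixMultiplication.MatrixMultiplication.Theorems

section Points

variable {d : ℕ}

/-- **Multivariate Lagrange interpolation**: a polynomial equal to `1` at `p` and `0` at the other points of a
finite set `P ⊂ ℂ^d` (product of affine-linear forms separating `p` from each `q ≠ p`). -/
theorem exists_mvPolynomial_indicator (P : Finset (Fin d → ℂ)) (p : Fin d → ℂ) :
    ∃ f : MvPolynomial (Fin d) ℂ, eval p f = 1 ∧ ∀ q ∈ P, q ≠ p → eval q f = 0 := by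
  classical
  have sep : ∀ q : Fin d → ℂ, ∃ ℓ : MvPolynomial (Fin d) ℂ, eval p ℓ = 1 ∧ (q ≠ p → eval q ℓ = 0) := by
    intro q
    by_cases hq : q = p
    · exact ⟨1, by simp, fun h => (h hq).elim⟩
    · obtain ⟨i, hi⟩ := Function.ne_iff.mp hq
      refine ⟨C (p i - q i)⁻¹ * (X i - C (q i)), ?_, fun _ => ?_⟩
      · have hne : p i - q i ≠ 0 := sub_ne_zero.mpr (Ne.symm hi)
        simp [hne]
      · simp
  choose ℓ hℓ1 hℓ0 using sep
  refine ⟨∏ q ∈ P.erase p, ℓ q, ?_, fun q hq hqp => ?_⟩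
  · rw [map_prod]
    exact Finset.prod_eq_one fun q _ => hℓ1 q
  · rw [map_prod]
    exact Finset.prod_eq_zero (Finset.mem_erase.mpr ⟨hqp, hq⟩) (hℓ0 q hqp)

/-- The structure tensor of `ℂ^P`-like algebras: in ANY basis `b` of the algebra of functions `ι → K` on a finite
set, `structureTensor b` is a restriction of the diagonal tensor, hence a sum of `|ι|` triads. -/
theorem exists_structureTensor_pi_eq_sum {K : Type*} [Field K] {ι κ : Type*} [Fintype ι] [DecidableEq ι]
    [Fintype κ] (b : Module.Basis κ K (ι → K)) :
    ∃ U V W : Fin (Fintype.card ι) → κ → K,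
      ∀ k i j, structureTensor b k i j = ∑ ρ, U ρ k * V ρ i * W ρ j := by
  obtain ⟨A, B, C, hABC⟩ :=
    structureTensor_restrictsTo_of_algEquiv b (Pi.basisFun K ι) (AlgEquiv.refl : (ι → K) ≃ₐ[K] (ι → K))
  set eq := Fintype.equivFin ι
  refine ⟨fun ρ k => A k (eq.symm ρ), fun ρ i => B i (eq.symm ρ), fun ρ j => C j (eq.symm ρ), fun k i j => ?_⟩
  rw [hABC]
  rw [← eq.symm.sum_comp]
  refine Finset.sum_congr rfl fun ρ _ => ?_
  rw [Finset.sum_eq_single (eq.symm ρ), Finset.sum_eq_single (eq.symm ρ)]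
  · simp [structureTensor_apply, Pi.basisFun_apply, Pi.basisFun_repr]
  · intro c _ hc
    simp [structureTensor_apply, Pi.basisFun_apply, Pi.basisFun_repr, hc]
  · simp
  · intro b' _ hb
    refine Finset.sum_eq_zero fun c _ => ?_
    simp [structureTensor_apply, Pi.basisFun_apply, Pi.basisFun_repr, Pi.single_apply, hb]
  · simp

/-- `stmt-MatrixMultiplication-5458` (`OrbitHarmonicsHosts.ReesBound`): for a finite point set `P ⊂ ℂ^d`, the
orbit-harmonics ring `ℂ[x]/⟨LF(I(P))⟩` has a basis indexed by `Fin |P|` whose structure tensor has border rank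
`≤ |P|` (Rees degeneration of `Fun(P) ≅ ℂ^|P|` to its associated graded for the degree filtration). -/
theorem reesBound_proof : Summit.MatrixMultiplication.MatrixMultiplication.Theses.OrbitHarmonicsHosts.ReesBound := by
  intro d P
  classical
  set I : Ideal (MvPolynomial (Fin d) ℂ) := vanishingIdeal ℂ (P : Set (Fin d → ℂ)) with hI
  set J : Ideal (MvPolynomial (Fin d) ℂ) := Ideal.span ((fun f : MvPolynomial (Fin d) ℂ =>
    homogeneousComponent f.totalDegree f) '' (I : Set (MvPolynomial (Fin d) ℂ))) with hJ
  have hIJ : ∀ g ∈ I, ∀ k, g.totalDegree ≤ k → homogeneousComponent k g ∈ J :=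
    fun g hg k hk => homogeneousComponent_mem_grSpan hg hk
  have hJ' : ∀ p ∈ J, ∀ k, ∃ g ∈ I, g.totalDegree ≤ k ∧
      homogeneousComponent k g = homogeneousComponent k p :=
    fun p hp k => exists_eq_homogeneousComponent_of_mem_grSpan hp k
  -- evaluation at the points of `P`
  set Φ : MvPolynomial (Fin d) ℂ →ₐ[ℂ] (↥P → ℂ) :=
    AlgHom.pi fun p : ↥P => aeval (R := ℂ) (p : Fin d → ℂ) with hΦ
  have hΦI : ∀ f, Φ f = 0 ↔ f ∈ I := by
    intro f
    rw [hI, mem_vanishingIdeal_iff, funext_iff]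
    simp only [hΦ, AlgHom.pi_apply, Pi.zero_apply, Subtype.forall, Finset.mem_coe]
  have hΦs : Function.Surjective Φ := by
    intro w
    choose χ hχ1 hχ0 using fun p : ↥P => exists_mvPolynomial_indicator P (p : Fin d → ℂ)
    refine ⟨∑ p, w p • χ p, ?_⟩
    funext q
    rw [map_sum, Finset.sum_apply, Finset.sum_eq_single q]
    · rw [map_smul, Pi.smul_apply, hΦ, AlgHom.pi_apply, smul_eq_mul]
      change w q * eval (q : Fin d → ℂ) (χ q) = w q
      rw [hχ1, mul_one]
    · intro p _ hpq
      rw [map_smul, Pi.smul_apply, hΦ, AlgHom.pi_apply, smul_eq_mul]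
      change w p * eval (q : Fin d → ℂ) (χ p) = 0
      rw [hχ0 p q q.2 (fun hqp => hpq (Subtype.ext hqp).symm), mul_zero]
    · intro hq
      exact absurd (Finset.mem_univ q) hq
  -- a homogeneous (monomial) basis of `A = R ⧸ J`
  set mkA := Ideal.Quotient.mkₐ ℂ J with hmkA
  obtain ⟨κ, a, -, hspan, hli⟩ :=
    exists_linearIndependent' (K := ℂ) (fun m : (Fin d →₀ ℕ) => mkA (monomial m 1))
  set h : κ → MvPolynomial (Fin d) ℂ := fun x => monomial (a x) 1 with hh
  have he : ∀ x, (h x).IsHomogeneous ((a x).degree) := fun x => isHomogeneous_monomial _ rfl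
  have htopA : ⊤ ≤ Submodule.span ℂ (Set.range fun x : κ => mkA (h x)) := by
    have h1 : (Set.range fun x : κ => mkA (h x)) =
        Set.range ((fun m : (Fin d →₀ ℕ) => mkA (monomial m 1)) ∘ a) := rfl
    have h2 : (fun m : (Fin d →₀ ℕ) => mkA (monomial m 1)) =
        ⇑mkA.toLinearMap ∘ ⇑(basisMonomials (Fin d) ℂ) := by
      funext m
      simp [coe_basisMonomials]
    rw [h1, hspan, h2, Set.range_comp, Submodule.span_image, (basisMonomials (Fin d) ℂ).span_eq,
      Submodule.map_top, LinearMap.range_eq_top.mpr]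
    exact Ideal.Quotient.mkₐ_surjective ℂ J
  set bA : Module.Basis κ ℂ (MvPolynomial (Fin d) ℂ ⧸ J) := Module.Basis.mk hli htopA with hbAdef
  have hbA : ∀ x, bA x = mkA (h x) := fun x => Module.Basis.mk_apply hli htopA x
  -- `Φ ∘ h` is a basis of `ℂ^P`, so the index type has `|P|` elements
  have hliB : LinearIndependent ℂ (fun x => Φ (h x)) :=
    linearIndependent_map_of_graded hIJ Φ (fun f hf => (hΦI f).mp hf) he bA hbA
  haveI : Finite κ := hliB.finite_of_isNoetherian
  letI : Fintype κ := Fintype.ofFinite κ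
  have hspB : ⊤ ≤ Submodule.span ℂ (Set.range fun x => Φ (h x)) :=
    span_map_eq_top_of_graded hJ' Φ (fun f hf => (hΦI f).mpr hf) hΦs he bA hbA
  set bB : Module.Basis κ ℂ (↥P → ℂ) := Module.Basis.mk hliB hspB with hbBdef
  have hbB : ∀ x, bB x = Φ (h x) := fun x => Module.Basis.mk_apply hliB hspB x
  have hcard : Fintype.card κ = P.card := by
    have h1 := Module.finrank_eq_card_basis bB
    rw [Module.finrank_fintype_fun_eq_card, Fintype.card_coe] at h1
    exact h1.symm
  -- structure constants modulo `I` from `ℂ^P`, with `|P|` triads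
  obtain ⟨U, V, W, hdec⟩ := exists_structureTensor_pi_eq_sum bB
  have hc : ∀ i j, h i * h j - ∑ k, structureTensor bB k i j • h k ∈ I := by
    intro i j
    rw [← hΦI, map_sub, map_mul, map_sum]
    simp_rw [map_smul, ← hbB, structureTensor_apply]
    rw [bB.sum_repr, sub_self]
  have hcore := algBorderRank_structureTensor_le_of_graded hIJ he bA hbA (structureTensor bB) hc U V W hdec
  rw [Fintype.card_coe] at hcore
  -- reindex by `Fin |P|`
  refine ⟨bA.reindex (Fintype.equivFinOfCardEq hcard), ?_⟩
  have hre : structureTensor (bA.reindex (Fintype.equivFinOfCardEq hcard)) = fun z x y =>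
      structureTensor bA ((Fintype.equivFinOfCardEq hcard).symm z)
        ((Fintype.equivFinOfCardEq hcard).symm x) ((Fintype.equivFinOfCardEq hcard).symm y) := by
    funext z x y
    simp [structureTensor_apply, Module.Basis.reindex_apply]
  rw [hre, algBorderRank_reindex]
  exact hcore

end Points

end Summit.MatrixMultiplication.MatrixMultiplication.Theorems

end
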